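import Summits.QuantumFields.BalabanUV.Beta.FP.WindowedBlockMass
import Summits.QuantumFields.BalabanUV.Beta.FP.AveragingJetLettersSecond

/-!
# `Beta/FP/AveragingJetLettersRootedSecond` — road «FP» (binder row D1), row **RHOA-6b′** (second jet): the SECOND averaging jet of a weighted family of
# ROOTED insertion paths in ORDERED NESTED kernel form `ker₂ b″ b′ c • [β_{b″},[β_{b′},φ_c]]`, its letters, and the (M₂) input `mass₂-marginal ≤ 2ℓ·mass₁`
# fed to `WindowedBlockMass` BY NAME ([folklore] finite bookkeeping; no road object)

HONEST FRAMING (cell `pub-balaban`, β sub-cell, verbatim): discharging `BetaPertH` makes Bałaban's UV stability UNCONDITIONAL — a real constructive-QFT result; it is NOT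
the continuum limit and NOT the Clay problem.  THIS MODULE discharges NOTHING of the series, of row D1, of `hbook`/`hasym`/`ρ_n`/`Mix_n`: [folklore] finite bookkeeping over node 6
(`avgJet₂`), gan24-leaf-04's per-contour algebra `AveragingJetLettersSecond.nested_form`∕`dc` (RHOA-6b part 3), `AveragingJetLettersRooted` (`wfld`, `mass₁`, block families) and
`WindowedBlockMass` BY NAME.  «not in print; our bookkeeping».  0 estimates of any Bałaban propagator; B12 (0.3)/(0.4), B5-I (1.11) are LOCATORS only.
HONEST DEPENDENCY: continuum YM on T⁴ ⇐ BetaPertH ∧ nine spine estimates (0/9 proved); BetaPertH ⇐ (D1) ∧ (D4) ∧ CAP+tail; G-an2-4 gates asym, D1 and NE2/3/4.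
ABSOLUTE RULE (cell charter, verbatim): «No internally-minted statement may enter as a cited fact. Every hypothesis is either kernel-proved in this package or a verbatim quotation
of a PUBLISHED theorem with page reference. The manuscript(s) under audit are NOT citable for their own disputed steps — they are the thing under adjudication; programme-internal
(2001/route/tribunal) claims are never citable.»  No `def … : Prop`, no citation tag; the data `def`s `posInd`, `pairW`, `ker₂` assert nothing.

THE ROW (owner R-FP-26 (b) as amended S5 (d), verbatim): «… the first∕second averaging jets at 𝟙 have: sup `≤ n⁻⁴`(×norm), radius `≤ ℓ`, MASS FUNCTION …»; RHOA-DESIGN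
§2bis (q̈): «likewise `n⁻³` per ordered pair of insertions».  The first jet is `AveragingJetLettersRooted` (p245346); THIS FILE is the second jet, same events
`(ω, fld, bg)`, same one-sided convention (background letters PRECEDING the field letter; node 6's `[S,[S,·]] + [C,·]` regrouped by gan24-leaf-04's Jacobi identity
into ORDERED NESTED double commutators — the OUTER letter is the one met first along the word).

WHAT IS TYPED.
* §1 WORDS: `posInd l i b` (positional indicator `[l[i]? = some b]`), `sum_posInd_eq_count` (`Σ_{i<|l|} posInd = count b l`), `sum_posInd_smul` (indicator expansion
  of a function of the letter), the ORDERED NESTED PAIR WEIGHT `pairW l b″ b′ = Σ_{j<|l|} Σ_{i≤j} w(i,j)·posInd l i b″·posInd l j b′` (`w = 1∣2`), `pairW_le` (`≤ 2·count b″·count b′`),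
  `sum_pairW_le_outer`∕`_inner` (one letter summed over ANY finite window: `≤ 2·count·|l|`), `sum_sum_pairW_le` (`≤ 2|l|²`), `mem_of_pairW_ne_zero`, and the per-word
  kernel form `nested_eq_sum_pairW`
  (`Σ_{j<s}Σ_{i≤j} w•dc (g i) (g j) A = Σ_{b″,b′∈S} pairW • dc (β b″) (β b′) A`, `nested_form` BY NAME).
* §2 GENERIC ROOTED FAMILY: **`ker₂ ω fld bg b″ b′ c := Σ_{e : fld e = c} ω e·pairW (bg e) b″ b′`**; KERNEL FORM **`avgJet₂_eq_sum_ker₂`**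
  (`avgJet₂ ℝ ω ((bg ·).map β) (φ ∘ fld) = Σ_{b″∈S}Σ_{b′∈S}Σ_{c∈T} ker₂ b″ b′ c • dc (β b″) (β b′) (φ c)`, any finite `S ⊇` letters, `T ⊇` field legs); LETTERS:
  `ker₂_nonneg`; SUPPORT `exists_of_ker₂_ne_zero`; SUP **`ker₂_le_mul_wfld`** (`count ≤ M ⟹ ker₂ ≤ 2M²·wfld c`); FIELD-SIDE `sum_sum_ker₂_le_mul_wfld` (`≤ 2ℓ²·wfld c`); the (M₂) INPUTS **`sum_ker₂_outer_le`** (`Σ_{b′∈S}Σ_{c∈T} ker₂ b″ b′ c ≤ 2ℓ·mass₁ b″`) and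
  `sum_ker₂_inner_le` (`Σ_{b″∈S}Σ_{c∈T} ker₂ b″ b′ c ≤ 2ℓ·mass₁ b′`) — so EVERY window letter of the first-jet mass function transfers with the factor `2ℓ`;
  TOTAL `sum_sum_ker₂_le` (`Σ_{b″,b′∈S}Σ_{c∈T} ker₂ ≤ 2ℓ²·Σ_e ω e`).
* §3 BLOCK FAMILIES (events `idx n × Σ`, `blkW`∕`blkFld`∕`blkBg` of the first-jet file): `blk_ker₂_sup_le` (`≤ 2M²·n⁻⁴·Σp`), `blk_ker₂_outer_le` (per-block window total
  `≤ 2(ℓ₀+n)·(ℓ₀+n)·Σp`), and the (M₂) letter **`blk_windowedMass₂_le_half`**: `Σ_{ℓ∈S} e^{−(δ∕(2n))‖pos ℓ − c₀‖}·Σ_{u∈Y} (Σ_{b′∈S′}Σ_{c∈T} ker₂^{(u)} ℓ b′ c)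
  ≤ (2(ℓ₀+n)·((ℓ₀+n)·Σp))·e^{δR₀∕2}·(e^{δ∕2}(1 + 480e^{δ∕4}(4∕δ)⁴))` via `WindowedBlockMass.windowedMass_le_half` + `blk_mass₁_local` BY NAME.
NOT TYPED HERE: the radial rules (comb ∕ S_D staircases), (MIX-4) power counting (RHOA-6c′), `Mix_n = O(1)` (RHOA-6e), hbook, D1, BetaPertH.  Provenance: cross-cell idle-seat
kernel duty NE7b → β∕D1, unit `b2b-balaban-t4-ne7b-formalise-leaf-02` gen 22, 2026-08-21; journal INTENT l.25930, owner «GO, THIS SHAPE» l.26002; no existing file touched.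
-/

noncomputable section

namespace Summit.QuantumFields.BalabanUV.Beta.FP.AveragingJetLettersRootedSecond

open Finset
open scoped BigOperators
open Literature.MathematicalPhysics.QuantumFieldTheory.Balaban1983to89.Beta.DyadicShell (Pt supNorm)
open Literature.MathematicalPhysics.QuantumFieldTheory.Balaban1983to89.Beta.AxialBlockWeights (idx pt)
open Literature.MathematicalPhysics.QuantumFieldTheory.Balaban1983to89.Beta.AdjointTransportJets (avgJet₂)
open Literature.MathematicalPhysics.QuantumFieldTheory.Balaban1983to89.Beta.TransportVertices (commSum)
open Summit.QuantumFields.BalabanUV.Beta.FP.AveragingJetLettersSecond (dc nested_form)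
open Summit.QuantumFields.BalabanUV.Beta.FP.AveragingJetLettersRooted
  (wfld mass₁ sum_count_le_length blkW blkFld blkBg blkW_nonneg blk_massFun_le length_blkBg_le mass₁_nonneg wfld_blk_le)
open Summit.QuantumFields.BalabanUV.Beta.FP.WindowedBlockMass (windowedMass_le_half blk_mass₁_local)

/-! ## §1 Words: positional indicators and the ordered nested pair weight -/

section Word

variable {B : Type*} [DecidableEq B]

/-- [our object] positional indicator: `1` if the `i`-th letter of `l` exists and is `b`, else `0`. -/
def posInd (l : List B) (i : ℕ) (b : B) : ℕ := if l[i]? = some b then 1 else 0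

/-- [folklore] in range, the indicator tests the letter: `posInd l i b = [l[i] = b]`. -/
theorem posInd_eq_ite (l : List B) {i : ℕ} (hi : i < l.length) (b : B) : posInd l i b = if l[i] = b then 1 else 0 := by
  unfold posInd
  simp [List.getElem?_eq_getElem hi]

/-- [folklore] **positions count letters**: `Σ_{i<|l|} posInd l i b = count b l`. -/
theorem sum_posInd_eq_count (l : List B) (b : B) : ∑ i ∈ range l.length, posInd l i b = l.count b := by
  induction l with
  | nil => simp
  | cons a l ih =>
    rw [List.length_cons, Finset.sum_range_succ', List.count_cons]
    have h0 : posInd (a :: l) 0 b = if (a == b) = true then 1 else 0 := by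
      unfold posInd; simp
    have hs : ∀ i, posInd (a :: l) (i + 1) b = posInd l i b := fun i => by unfold posInd; simp
    simp_rw [hs]
    rw [ih, h0]

/-- [folklore] in range, the indicator expansion of a function of the letter: `Σ_{b∈S} posInd l i b • X b = X l[i]` when `l[i] ∈ S`. -/
theorem sum_posInd_smul {M : Type*} [AddCommMonoid M] (l : List B) {i : ℕ} (hi : i < l.length) (S : Finset B) (hS : l[i] ∈ S)
    (X : B → M) : ∑ b ∈ S, posInd l i b • X b = X l[i] := by
  simp_rw [posInd_eq_ite l hi]
  have h : ∀ b ∈ S, (if l[i] = b then 1 else 0) • X b = if l[i] = b then X b else 0 := fun b _ => by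
    split_ifs <;> simp
  rw [Finset.sum_congr rfl h, Finset.sum_ite_eq, if_pos hS]

/-- [our object] THE ORDERED NESTED PAIR WEIGHT of the word `l`: `pairW l b″ b′ = Σ_{j<|l|} Σ_{i≤j} w(i,j)·[l[i] = b″]·[l[j] = b′]`, `w = 1` on the diagonal and
`2` off it (gan24-leaf-04's Jacobi regrouping; OUTER letter `b″` met first along the word, INNER letter `b′`). -/
def pairW (l : List B) (b'' b' : B) : ℕ :=
  ∑ j ∈ range l.length, ∑ i ∈ range (j + 1), (if i = j then 1 else 2) * (posInd l i b'' * posInd l j b')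

/-- [folklore] (SUP per word) `pairW l b″ b′ ≤ 2·count b″ l·count b′ l`. -/
theorem pairW_le (l : List B) (b'' b' : B) : pairW l b'' b' ≤ 2 * (l.count b'' * l.count b') := by
  unfold pairW
  calc ∑ j ∈ range l.length, ∑ i ∈ range (j + 1), (if i = j then 1 else 2) * (posInd l i b'' * posInd l j b')
      ≤ ∑ j ∈ range l.length, ∑ i ∈ range l.length, 2 * (posInd l i b'' * posInd l j b') := by
        refine Finset.sum_le_sum fun j hj => ?_
        have hj' : j + 1 ≤ l.length := mem_range.mp hj
        calc ∑ i ∈ range (j + 1), (if i = j then 1 else 2) * (posInd l i b'' * posInd l j b')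
            ≤ ∑ i ∈ range (j + 1), 2 * (posInd l i b'' * posInd l j b') :=
              Finset.sum_le_sum fun i _ => Nat.mul_le_mul_right _ (by split_ifs <;> omega)
          _ ≤ ∑ i ∈ range l.length, 2 * (posInd l i b'' * posInd l j b') :=
              Finset.sum_le_sum_of_subset_of_nonneg (fun i hi => mem_range.mpr (by have := mem_range.mp hi; omega))
                fun _ _ _ => Nat.zero_le _
    _ = 2 * (l.count b'' * l.count b') := by
        rw [← sum_posInd_eq_count l b'', ← sum_posInd_eq_count l b', Finset.sum_mul_sum, Finset.mul_sum, Finset.sum_comm]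
        refine Finset.sum_congr rfl fun j _ => ?_
        rw [Finset.mul_sum]

/-- [folklore] (OUTER MARGINAL per word) `Σ_{b′∈S} pairW l b″ b′ ≤ 2·count b″ l·|l|` for every finite `S`. -/
theorem sum_pairW_le_outer (l : List B) (b'' : B) (S : Finset B) : ∑ b' ∈ S, pairW l b'' b' ≤ 2 * (l.count b'' * l.length) := by
  calc ∑ b' ∈ S, pairW l b'' b' ≤ ∑ b' ∈ S, 2 * (l.count b'' * l.count b') := Finset.sum_le_sum fun b' _ => pairW_le l b'' b'
    _ = 2 * (l.count b'' * ∑ b' ∈ S, l.count b') := by rw [← Finset.mul_sum, ← Finset.mul_sum]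
    _ ≤ 2 * (l.count b'' * l.length) := by
        have := sum_count_le_length l S
        gcongr

/-- [folklore] (INNER MARGINAL per word) `Σ_{b″∈S} pairW l b″ b′ ≤ 2·|l|·count b′ l` for every finite `S`. -/
theorem sum_pairW_le_inner (l : List B) (b' : B) (S : Finset B) : ∑ b'' ∈ S, pairW l b'' b' ≤ 2 * (l.length * l.count b') := by
  calc ∑ b'' ∈ S, pairW l b'' b' ≤ ∑ b'' ∈ S, 2 * (l.count b'' * l.count b') := Finset.sum_le_sum fun b'' _ => pairW_le l b'' b'
    _ = 2 * ((∑ b'' ∈ S, l.count b'') * l.count b') := by rw [Finset.sum_mul, Finset.mul_sum]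
    _ ≤ 2 * (l.length * l.count b') := by
        have := sum_count_le_length l S
        gcongr

/-- [folklore] (PAIR TOTAL per word) `Σ_{b″∈S} Σ_{b′∈S} pairW l b″ b′ ≤ 2·|l|²` for every finite `S`. -/
theorem sum_sum_pairW_le (l : List B) (S : Finset B) : ∑ b'' ∈ S, ∑ b' ∈ S, pairW l b'' b' ≤ 2 * l.length ^ 2 := by
  calc ∑ b'' ∈ S, ∑ b' ∈ S, pairW l b'' b' ≤ ∑ b'' ∈ S, 2 * (l.count b'' * l.length) :=
        Finset.sum_le_sum fun b'' _ => sum_pairW_le_outer l b'' S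
    _ = 2 * ((∑ b'' ∈ S, l.count b'') * l.length) := by rw [Finset.sum_mul, Finset.mul_sum]
    _ ≤ 2 * (l.length * l.length) := by have := sum_count_le_length l S; gcongr
    _ = 2 * l.length ^ 2 := by rw [sq]

/-- [folklore] (SUPPORT per word) a nonzero pair weight forces both letters into the word. -/
theorem mem_of_pairW_ne_zero {l : List B} {b'' b' : B} (h : pairW l b'' b' ≠ 0) : b'' ∈ l ∧ b' ∈ l := by
  have h2 := pairW_le l b'' b'
  have hpos : 0 < l.count b'' * l.count b' := by omega
  refine ⟨List.count_pos_iff.mp (Nat.pos_of_ne_zero fun h0 => ?_), List.count_pos_iff.mp (Nat.pos_of_ne_zero fun h0 => ?_)⟩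
  · rw [h0, zero_mul] at hpos; exact lt_irrefl 0 hpos
  · rw [h0, mul_zero] at hpos; exact lt_irrefl 0 hpos

omit [DecidableEq B] in
/-- [folklore] the positional letter function of a word (zero out of range) reproduces the mapped word. -/
theorem map_range_posLetter {𝔸 : Type*} [NormedRing 𝔸] (l : List B) (β : B → 𝔸) :
    (List.range l.length).map (fun i => if h : i < l.length then β l[i] else 0) = l.map β := by
  refine List.ext_getElem (by simp) fun i h₁ h₂ => ?_
  rw [List.length_map, List.length_range] at h₁
  simp [List.getElem_map, List.getElem_range, h₁]

/-- [folklore] THE PER-WORD KERNEL FORM: `Σ_{j<|l|} Σ_{i≤j} w(i,j)•[β l[i],[β l[j],A]] = Σ_{b″∈S} Σ_{b′∈S} pairW l b″ b′ • [β b″,[β b′,A]]` for any finite `S`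
containing the letters of `l`. -/
theorem nested_eq_sum_pairW {𝔸 : Type*} [NormedRing 𝔸] (l : List B) (β : B → 𝔸) (A : 𝔸) (S : Finset B) (hS : ∀ b ∈ l, b ∈ S) :
    ∑ j ∈ range l.length, ∑ i ∈ range (j + 1), (if i = j then 1 else 2) •
        dc ((fun i => if h : i < l.length then β l[i] else 0) i) ((fun i => if h : i < l.length then β l[i] else 0) j) A
      = ∑ b'' ∈ S, ∑ b' ∈ S, pairW l b'' b' • dc (β b'') (β b') A := by
  -- expand each in-range term through the indicators
  have hexp : ∀ j ∈ range l.length, ∀ i ∈ range (j + 1),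
      (if i = j then 1 else 2) • dc ((fun i => if h : i < l.length then β l[i] else 0) i)
          ((fun i => if h : i < l.length then β l[i] else 0) j) A
        = ∑ b'' ∈ S, ∑ b' ∈ S, ((if i = j then 1 else 2) * (posInd l i b'' * posInd l j b')) • dc (β b'') (β b') A := by
    intro j hj i hi
    have hj' : j < l.length := mem_range.mp hj
    have hi' : i < l.length := by have := mem_range.mp hi; omega
    simp only [hj', hi', dif_pos]
    have hiS : l[i] ∈ S := hS _ (List.getElem_mem hi')
    have hjS : l[j] ∈ S := hS _ (List.getElem_mem hj')
    symm
    calc ∑ b'' ∈ S, ∑ b' ∈ S, ((if i = j then 1 else 2) * (posInd l i b'' * posInd l j b')) • dc (β b'') (β b') A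
        = (if i = j then 1 else 2) • ∑ b'' ∈ S, posInd l i b'' • ∑ b' ∈ S, posInd l j b' • dc (β b'') (β b') A := by
          rw [Finset.smul_sum]
          refine Finset.sum_congr rfl fun b'' _ => ?_
          rw [Finset.smul_sum, Finset.smul_sum]
          refine Finset.sum_congr rfl fun b' _ => ?_
          rw [smul_smul, smul_smul, mul_assoc]
      _ = (if i = j then 1 else 2) • dc (β l[i]) (β l[j]) A := by
          congr 1
          rw [sum_posInd_smul l hi' S hiS]
          exact sum_posInd_smul l hj' S hjS _
  rw [Finset.sum_congr rfl fun j hj => Finset.sum_congr rfl fun i hi => hexp j hj i hi]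
  -- swap the position sums inside the label sums
  calc ∑ j ∈ range l.length, ∑ i ∈ range (j + 1), ∑ b'' ∈ S, ∑ b' ∈ S,
          ((if i = j then 1 else 2) * (posInd l i b'' * posInd l j b')) • dc (β b'') (β b') A
      = ∑ j ∈ range l.length, ∑ b'' ∈ S, ∑ i ∈ range (j + 1), ∑ b' ∈ S,
          ((if i = j then 1 else 2) * (posInd l i b'' * posInd l j b')) • dc (β b'') (β b') A :=
        Finset.sum_congr rfl fun j _ => Finset.sum_comm
    _ = ∑ b'' ∈ S, ∑ j ∈ range l.length, ∑ i ∈ range (j + 1), ∑ b' ∈ S,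
          ((if i = j then 1 else 2) * (posInd l i b'' * posInd l j b')) • dc (β b'') (β b') A := Finset.sum_comm
    _ = ∑ b'' ∈ S, ∑ j ∈ range l.length, ∑ b' ∈ S, ∑ i ∈ range (j + 1),
          ((if i = j then 1 else 2) * (posInd l i b'' * posInd l j b')) • dc (β b'') (β b') A :=
        Finset.sum_congr rfl fun b'' _ => Finset.sum_congr rfl fun j _ => Finset.sum_comm
    _ = ∑ b'' ∈ S, ∑ b' ∈ S, ∑ j ∈ range l.length, ∑ i ∈ range (j + 1),
          ((if i = j then 1 else 2) * (posInd l i b'' * posInd l j b')) • dc (β b'') (β b') A :=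
        Finset.sum_congr rfl fun b'' _ => Finset.sum_comm
    _ = ∑ b'' ∈ S, ∑ b' ∈ S, pairW l b'' b' • dc (β b'') (β b') A := by
        refine Finset.sum_congr rfl fun b'' _ => Finset.sum_congr rfl fun b' _ => ?_
        rw [pairW, Finset.sum_smul]
        exact Finset.sum_congr rfl fun j _ => by rw [Finset.sum_smul]

end Word

/-! ## §2 The generic rooted family: the second-jet kernel and its letters -/

section Generic

variable {ι : Type*} [Fintype ι] {B : Type*} [DecidableEq B] {C : Type*} [DecidableEq C]

/-- [our object] THE SECOND-JET KERNEL `ker₂ b″ b′ c = Σ_{e : fld e = c} ω e·pairW (bg e) b″ b′` (outer letter `b″`, inner letter `b′`, field leg `c`). -/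
def ker₂ (ω : ι → ℝ) (fld : ι → C) (bg : ι → List B) (b'' b' : B) (c : C) : ℝ :=
  ∑ e ∈ univ.filter (fun e => fld e = c), ω e * (pairW (bg e) b'' b' : ℝ)

variable {ω : ι → ℝ} {fld : ι → C} {bg : ι → List B}

/-- [folklore] `ker₂ ≥ 0` for nonnegative weights. -/
theorem ker₂_nonneg (hω : ∀ e, 0 ≤ ω e) (b'' b' : B) (c : C) : 0 ≤ ker₂ ω fld bg b'' b' c :=
  Finset.sum_nonneg fun e _ => mul_nonneg (hω e) (Nat.cast_nonneg _)

/-- [folklore] (SUP) `count b″ (bg e) ≤ M`, `count b′ (bg e) ≤ M` for every event ⟹ `ker₂ b″ b′ c ≤ 2M²·wfld c`. -/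
theorem ker₂_le_mul_wfld (hω : ∀ e, 0 ≤ ω e) {M : ℕ} {b'' b' : B} (hM'' : ∀ e, (bg e).count b'' ≤ M) (hM' : ∀ e, (bg e).count b' ≤ M)
    (c : C) : ker₂ ω fld bg b'' b' c ≤ (2 * (M : ℝ) ^ 2) * wfld ω fld c := by
  unfold ker₂ wfld
  rw [Finset.mul_sum]
  refine Finset.sum_le_sum fun e _ => ?_
  rw [mul_comm (2 * (M : ℝ) ^ 2)]
  refine mul_le_mul_of_nonneg_left ?_ (hω e)
  have h := (pairW_le (bg e) b'' b').trans (Nat.mul_le_mul_left 2 (Nat.mul_le_mul (hM'' e) (hM' e)))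
  have h' : (pairW (bg e) b'' b' : ℝ) ≤ ((2 * (M * M) : ℕ) : ℝ) := by exact_mod_cast h
  simpa [sq, mul_assoc] using h'

/-- [folklore] SUPPORT: a nonzero `ker₂ b″ b′ c` is witnessed by an event with field leg `c` whose background word contains both letters (so every RADIUS letter of
the first jet transfers, as in `AveragingJetLettersRooted.ker₁_eq_zero_of_rel`). -/
theorem exists_of_ker₂_ne_zero {b'' b' : B} {c : C} (h : ker₂ ω fld bg b'' b' c ≠ 0) : ∃ e, fld e = c ∧ b'' ∈ bg e ∧ b' ∈ bg e := by
  by_contra hne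
  push Not at hne
  apply h
  refine Finset.sum_eq_zero fun e he => ?_
  have hc : fld e = c := (Finset.mem_filter.mp he).2
  have h0 : pairW (bg e) b'' b' = 0 := by
    by_contra hp
    obtain ⟨h1, h2⟩ := mem_of_pairW_ne_zero hp
    exact hne e hc h1 h2
  rw [h0, Nat.cast_zero, mul_zero]

/-- [folklore] (FIELD-SIDE) `|bg e| ≤ ℓ` ⟹ `Σ_{b″∈S} Σ_{b′∈S} ker₂ b″ b′ c ≤ 2ℓ²·wfld c` for every field leg `c` and every finite `S`. -/
theorem sum_sum_ker₂_le_mul_wfld (hω : ∀ e, 0 ≤ ω e) {ℓ : ℕ} (hℓ : ∀ e, (bg e).length ≤ ℓ) (S : Finset B) (c : C) :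
    ∑ b'' ∈ S, ∑ b' ∈ S, ker₂ ω fld bg b'' b' c ≤ (2 * (ℓ : ℝ) ^ 2) * wfld ω fld c := by
  unfold ker₂ wfld
  -- move the event sum outside
  have h1 : ∀ b'' ∈ S, ∑ b' ∈ S, ∑ e ∈ univ.filter (fun e => fld e = c), ω e * (pairW (bg e) b'' b' : ℝ)
      = ∑ e ∈ univ.filter (fun e => fld e = c), ∑ b' ∈ S, ω e * (pairW (bg e) b'' b' : ℝ) := fun _ _ => Finset.sum_comm
  rw [Finset.sum_congr rfl h1, Finset.sum_comm, Finset.mul_sum]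
  refine Finset.sum_le_sum fun e _ => ?_
  simp_rw [← Finset.mul_sum]
  rw [mul_comm (2 * (ℓ : ℝ) ^ 2)]
  refine mul_le_mul_of_nonneg_left ?_ (hω e)
  have h' : (∑ b'' ∈ S, ∑ b' ∈ S, (pairW (bg e) b'' b' : ℝ)) ≤ ((2 * (bg e).length ^ 2 : ℕ) : ℝ) := by
    exact_mod_cast sum_sum_pairW_le (bg e) S
  refine h'.trans ?_
  have hl : ((bg e).length : ℝ) ≤ ℓ := by exact_mod_cast hℓ e
  push_cast
  nlinarith [Nat.cast_nonneg (α := ℝ) (bg e).length]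

/-- [folklore] the common skeleton of both (M₂) marginals: a per-word slice bound `Σ_{x∈S} P l x ≤ 2·count b₀ l·|l|` lifts through the events to `≤ 2ℓ·mass₁ b₀`. -/
theorem sum_slice_le_mass₁ (hω : ∀ e, 0 ≤ ω e) {ℓ : ℕ} (hℓ : ∀ e, (bg e).length ≤ ℓ) (S : Finset B) (T : Finset C) (P : List B → B → ℕ)
    (b₀ : B) (hP : ∀ l : List B, ∑ x ∈ S, P l x ≤ 2 * (l.count b₀ * l.length)) :
    ∑ x ∈ S, ∑ c ∈ T, ∑ e ∈ univ.filter (fun e => fld e = c), ω e * (P (bg e) x : ℝ) ≤ (2 * (ℓ : ℝ)) * mass₁ ω bg b₀ := by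
  classical
  unfold mass₁
  have h1 : ∀ x ∈ S, ∑ c ∈ T, ∑ e ∈ univ.filter (fun e => fld e = c), ω e * (P (bg e) x : ℝ) ≤ ∑ e, ω e * (P (bg e) x : ℝ) := by
    intro x _
    have h := Finset.sum_fiberwise_le_sum_of_sum_fiber_nonneg (s := (univ : Finset ι)) (t := T) (g := fld)
      (f := fun e => ω e * (P (bg e) x : ℝ)) (fun c _ => Finset.sum_nonneg fun e _ => mul_nonneg (hω e) (Nat.cast_nonneg _))
    simpa using h
  refine (Finset.sum_le_sum h1).trans ?_
  rw [Finset.sum_comm, Finset.mul_sum]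
  refine Finset.sum_le_sum fun e _ => ?_
  rw [← Finset.mul_sum, mul_left_comm]
  refine mul_le_mul_of_nonneg_left ?_ (hω e)
  have h' : (∑ x ∈ S, (P (bg e) x : ℝ)) ≤ ((2 * ((bg e).count b₀ * (bg e).length) : ℕ) : ℝ) := by exact_mod_cast hP (bg e)
  refine h'.trans ?_
  have hl : ((bg e).length : ℝ) ≤ ℓ := by exact_mod_cast hℓ e
  push_cast
  nlinarith [Nat.cast_nonneg (α := ℝ) ((bg e).count b₀)]

/-- [folklore] **(M₂) INPUT, OUTER LETTER**: `|bg e| ≤ ℓ` ⟹ `Σ_{b′∈S} Σ_{c∈T} ker₂ b″ b′ c ≤ 2ℓ·mass₁ b″` for ALL finite windows — every window letter of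
the first-jet mass function transfers to the second jet with the factor `2ℓ`. -/
theorem sum_ker₂_outer_le (hω : ∀ e, 0 ≤ ω e) {ℓ : ℕ} (hℓ : ∀ e, (bg e).length ≤ ℓ) (b'' : B) (S : Finset B) (T : Finset C) :
    ∑ b' ∈ S, ∑ c ∈ T, ker₂ ω fld bg b'' b' c ≤ (2 * (ℓ : ℝ)) * mass₁ ω bg b'' :=
  sum_slice_le_mass₁ hω hℓ S T (fun l x => pairW l b'' x) b'' fun l => sum_pairW_le_outer l b'' S

/-- [folklore] (M₂) INPUT, INNER LETTER: `|bg e| ≤ ℓ` ⟹ `Σ_{b″∈S} Σ_{c∈T} ker₂ b″ b′ c ≤ 2ℓ·mass₁ b′` for ALL finite windows. -/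
theorem sum_ker₂_inner_le (hω : ∀ e, 0 ≤ ω e) {ℓ : ℕ} (hℓ : ∀ e, (bg e).length ≤ ℓ) (b' : B) (S : Finset B) (T : Finset C) :
    ∑ b'' ∈ S, ∑ c ∈ T, ker₂ ω fld bg b'' b' c ≤ (2 * (ℓ : ℝ)) * mass₁ ω bg b' :=
  sum_slice_le_mass₁ hω hℓ S T (fun l x => pairW l x b') b' fun l => by
    simpa only [mul_comm (l.length)] using sum_pairW_le_inner l b' S

/-- [folklore] (TOTAL) `|bg e| ≤ ℓ` ⟹ `Σ_{b″∈S} Σ_{b′∈S} Σ_{c∈T} ker₂ b″ b′ c ≤ 2ℓ²·Σ_e ω e` for ALL finite windows. -/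
theorem sum_sum_ker₂_le (hω : ∀ e, 0 ≤ ω e) {ℓ : ℕ} (hℓ : ∀ e, (bg e).length ≤ ℓ) (S : Finset B) (T : Finset C) :
    ∑ b'' ∈ S, ∑ b' ∈ S, ∑ c ∈ T, ker₂ ω fld bg b'' b' c ≤ (2 * (ℓ : ℝ) ^ 2) * ∑ e, ω e := by
  calc ∑ b'' ∈ S, ∑ b' ∈ S, ∑ c ∈ T, ker₂ ω fld bg b'' b' c
      ≤ ∑ b'' ∈ S, (2 * (ℓ : ℝ)) * mass₁ ω bg b'' := Finset.sum_le_sum fun b'' _ => sum_ker₂_outer_le hω hℓ b'' S T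
    _ = (2 * (ℓ : ℝ)) * ∑ b'' ∈ S, mass₁ ω bg b'' := by rw [Finset.mul_sum]
    _ ≤ (2 * (ℓ : ℝ)) * ((ℓ : ℝ) * ∑ e, ω e) :=
        mul_le_mul_of_nonneg_left (AveragingJetLettersRooted.sum_mass₁_le hω hℓ S) (by positivity)
    _ = (2 * (ℓ : ℝ) ^ 2) * ∑ e, ω e := by ring

/-- **THE KERNEL FORM OF THE SECOND JET**: for any finite `S ⊇` background letters and `T ⊇` field legs,
`avgJet₂ ℝ ω ((bg ·).map β) (φ ∘ fld) = Σ_{b″∈S} Σ_{b′∈S} Σ_{c∈T} ker₂ b″ b′ c • [β b″,[β b′, φ c]]`. [folklore] -/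
theorem avgJet₂_eq_sum_ker₂ {𝔸 : Type*} [NormedRing 𝔸] [NormedAlgebra ℝ 𝔸] (ω : ι → ℝ) (fld : ι → C) (bg : ι → List B) (S : Finset B) (T : Finset C)
    (hS : ∀ e, ∀ b ∈ bg e, b ∈ S) (hT : ∀ e, fld e ∈ T) (β : B → 𝔸) (φ : C → 𝔸) :
    avgJet₂ ℝ ω (fun e => (bg e).map β) (fun e => φ (fld e))
      = ∑ b'' ∈ S, ∑ b' ∈ S, ∑ c ∈ T, ker₂ ω fld bg b'' b' c • dc (β b'') (β b') (φ c) := by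
  classical
  unfold avgJet₂
  -- per event: node 6's form = the ordered nested form (gan24-leaf-04) = the `pairW` kernel form
  have h1 : ∀ e, ω e • ((((bg e).map β).sum * ((((bg e).map β).sum * φ (fld e) - φ (fld e) * ((bg e).map β).sum))
        - ((((bg e).map β).sum * φ (fld e) - φ (fld e) * ((bg e).map β).sum)) * ((bg e).map β).sum)
        + (commSum ((bg e).map β) * φ (fld e) - φ (fld e) * commSum ((bg e).map β)))
      = ∑ b'' ∈ S, ∑ b' ∈ S, (ω e * (pairW (bg e) b'' b' : ℝ)) • dc (β b'') (β b') (φ (fld e)) := by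
    intro e
    rw [← map_range_posLetter (bg e) β, nested_form _ (φ (fld e)) (bg e).length,
      nested_eq_sum_pairW (bg e) β (φ (fld e)) S (hS e), Finset.smul_sum]
    refine Finset.sum_congr rfl fun b'' _ => ?_
    rw [Finset.smul_sum]
    refine Finset.sum_congr rfl fun b' _ => ?_
    rw [← Nat.cast_smul_eq_nsmul ℝ, smul_smul]
  simp_rw [h1]
  rw [Finset.sum_comm]
  refine Finset.sum_congr rfl fun b'' _ => ?_
  rw [Finset.sum_comm]
  refine Finset.sum_congr rfl fun b' _ => ?_
  rw [← Finset.sum_fiberwise_of_maps_to (s := (univ : Finset ι)) (t := T) (g := fld) (fun e _ => hT e)]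
  refine Finset.sum_congr rfl fun c _ => ?_
  unfold ker₂
  rw [Finset.sum_smul]
  refine Finset.sum_congr rfl fun e he => ?_
  rw [(Finset.mem_filter.mp he).2]

end Generic

/-! ## §3 Block families: the second-jet letters and the (M₂) windowed letter BY NAME -/

section Block

variable {σ : Type*} [Fintype σ] {B : Type*} [DecidableEq B]
variable {n : ℕ} {μ : Fin 4} {y : Pt} {p : σ → ℝ} {rad : σ → Pt → Pt → List B} {strB : Pt → B} {ℓ₀ : ℕ}

/-- [folklore] **SUP, block instance**: `count ≤ M` for both letters ⟹ `ker₂ b″ b′ c ≤ 2M²·n⁻⁴·Σ_σ p σ`. -/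
theorem blk_ker₂_sup_le (hn : 1 ≤ n) (hp : ∀ s, 0 ≤ p s) {M : ℕ} {b'' b' : B}
    (hM'' : ∀ e, (blkBg n μ y rad strB e).count b'' ≤ M) (hM' : ∀ e, (blkBg n μ y rad strB e).count b' ≤ M) (c : Pt) :
    ker₂ (blkW n p) (blkFld n μ y) (blkBg n μ y rad strB) b'' b' c ≤ (2 * (M : ℝ) ^ 2) * (((n : ℝ) ^ 4)⁻¹ * ∑ s, p s) :=
  (ker₂_le_mul_wfld (blkW_nonneg n hp) hM'' hM' c).trans
    (mul_le_mul_of_nonneg_left (wfld_blk_le hn μ y hp c) (by positivity))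

/-- [folklore] **OUTER-LETTER WINDOW TOTAL per coarse bond, block instance**: `Σ_{ℓ∈S} Σ_{b′∈S′} Σ_{c∈T} ker₂ ℓ b′ c ≤ 2(ℓ₀+n)·((ℓ₀+n)·Σp)`. -/
theorem blk_ker₂_outer_le (hn : 1 ≤ n) (hp : ∀ s, 0 ≤ p s) (hrad : ∀ s x', (rad s y x').length ≤ ℓ₀)
    (S S' : Finset B) (T : Finset Pt) :
    ∑ b'' ∈ S, ∑ b' ∈ S', ∑ c ∈ T, ker₂ (blkW n p) (blkFld n μ y) (blkBg n μ y rad strB) b'' b' c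
      ≤ (2 * ((ℓ₀ + n : ℕ) : ℝ)) * (((ℓ₀ + n : ℕ) : ℝ) * ∑ s, p s) := by
  calc ∑ b'' ∈ S, ∑ b' ∈ S', ∑ c ∈ T, ker₂ (blkW n p) (blkFld n μ y) (blkBg n μ y rad strB) b'' b' c
      ≤ ∑ b'' ∈ S, (2 * ((ℓ₀ + n : ℕ) : ℝ)) * mass₁ (blkW n p) (blkBg n μ y rad strB) b'' :=
        Finset.sum_le_sum fun b'' _ => sum_ker₂_outer_le (blkW_nonneg n hp) (length_blkBg_le μ y strB hrad) b'' S' T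
    _ = (2 * ((ℓ₀ + n : ℕ) : ℝ)) * ∑ b'' ∈ S, mass₁ (blkW n p) (blkBg n μ y rad strB) b'' := by rw [Finset.mul_sum]
    _ ≤ _ := mul_le_mul_of_nonneg_left (blk_massFun_le hn hp hrad S) (by positivity)

/-- **(M₂) FOR RHOA-6b′'s BLOCK FAMILIES, HALF RATE** ([folklore]): the outer-letter marginal of the second-jet kernel, windowed exactly as RHOA-6c′'s (M),
`Σ_{ℓ∈S} e^{−(δ∕(2n))‖pos ℓ − c₀‖∞}·Σ_{u∈Y} (Σ_{b′∈S′}Σ_{c∈T} ker₂^{(u)} ℓ b′ c) ≤ (2(ℓ₀+n)·((ℓ₀+n)·Σp))·e^{δR₀∕2}·(e^{δ∕2}·(1 + 480·e^{δ∕4}(4∕δ)⁴))`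
for ALL finite `S`, `S′`, `T`, `Y` and every centre `c₀` — `WindowedBlockMass.windowedMass_le_half` with (T) = `sum_ker₂_outer_le` ⊙ `blk_massFun_le` and
(L) inherited from `blk_mass₁_local` (a nonzero marginal forces a nonzero `mass₁`). -/
theorem blk_windowedMass₂_le_half {δ : ℝ} (hδ : 0 < δ) (hn : 1 ≤ n) (μ : Fin 4) (hp : ∀ s, 0 ≤ p s)
    (hrad : ∀ s u x', (rad s u x').length ≤ ℓ₀) (pos : B → Pt) {R₀ : ℝ} (hR₀ : 2 ≤ R₀) (hstr : ∀ z, pos (strB z) = z)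
    (hradR : ∀ (s : σ) (u : Pt) (q : ↥(idx n)) (ℓ : B), ℓ ∈ rad s u q.1.1 → (supNorm (pos ℓ - (n : ℤ) • u) : ℝ) ≤ R₀ * n)
    (S S' : Finset B) (T Y : Finset Pt) (c₀ : Pt) :
    ∑ ℓ ∈ S, Real.exp (-(δ / (2 * n)) * (supNorm (pos ℓ - c₀) : ℝ)) *
        ∑ u ∈ Y, ∑ b' ∈ S', ∑ c ∈ T, ker₂ (blkW n p) (blkFld n μ u) (blkBg n μ u rad strB) ℓ b' c
      ≤ ((2 * ((ℓ₀ + n : ℕ) : ℝ)) * (((ℓ₀ + n : ℕ) : ℝ) * ∑ s, p s)) * Real.exp (δ * R₀ / 2) *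
          (Real.exp (δ / 2) * (1 + 480 * Real.exp (δ / 4) * (4 / δ) ^ 4)) := by
  have hω : ∀ u : Pt, ∀ e : ↥(idx n) × σ, 0 ≤ blkW n p e := fun _ e => blkW_nonneg n hp e
  refine windowedMass_le_half pos hδ hn
    (m := fun u ℓ => ∑ b' ∈ S', ∑ c ∈ T, ker₂ (blkW n p) (blkFld n μ u) (blkBg n μ u rad strB) ℓ b' c)
    (fun u ℓ => Finset.sum_nonneg fun _ _ => Finset.sum_nonneg fun _ _ => ker₂_nonneg (hω u) _ _ _)
    (fun u S₁ => blk_ker₂_outer_le hn hp (hrad · u ·) S₁ S' T) (fun u ℓ hne => ?_) S Y c₀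
  -- locality: a nonzero outer marginal forces a nonzero first-jet mass at `ℓ`
  have hle := sum_ker₂_outer_le (hω u) (length_blkBg_le μ u strB (hrad · u ·)) ℓ S' T (fld := blkFld n μ u)
  have hm : mass₁ (blkW n p) (blkBg n μ u rad strB) ℓ ≠ 0 := by
    intro h0
    rw [h0, mul_zero] at hle
    exact hne (le_antisymm hle (Finset.sum_nonneg fun _ _ => Finset.sum_nonneg fun _ _ => ker₂_nonneg (hω u) _ _ _))
  exact blk_mass₁_local μ u pos hR₀ hstr (fun s q ℓ' h' => hradR s u q ℓ' h') hm

end Block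

end Summit.QuantumFields.BalabanUV.Beta.FP.AveragingJetLettersRootedSecond

end
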